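import Summits.ValiantsHypothesis.ValiantsHypothesis.Theorems.DefinabilityGapSymmetry
import HarnessLib

/-!
# DefinabilityGap — BLOCK MERGING: the restriction `z_b ↦ z_a` realised inside the planted design

Route `route-ValiantsHypothesis-DefinabilityGap` (decomp-valiant, lens 5: hardness–randomness / PIT axis); width
road of the read-once leaf F4 / W10 (`KIPlantedHittingRO`, stmt-ValiantsHypothesis-23704, aside), on top of
`DefinabilityGapSymmetry` (`quadDesign_fst`) and `DefinabilityGapAffineRung` (`quadDesign_isNWDesign`,
`kiPer_eq_rename_cellEmb`). `G_m : y ↦ (P_c(y))_c`, `P_c = kiPer m c`, `φ = bind₁ (kiPer m)`.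
ELEMENTARY · NEW-COMBINATION (claimed: variable-identification closure of the planted NW generator realised
seed-side; Dvir–Shpilka / Kayal–Saraf restrictions act on identities, here on f ≠ 0 after φ) · 0 S-currency ·
closes NO item · graphical forms z_a − z_b only; fan-in ≥ 4, general affine forms and the leaf regime w = q^b ≫ m
NOT claimed · K1 / stmt-23704 / VP ≠ VNP untouched.

## The mechanism (§1)

The quadratic-curve design is ROW-FAITHFUL: position `k` of curve `c` is the seed `(k, w_c k)` (`quadDesign_fst`),
so `P_c = wordPoly (w_c)` is the permanent read along the COLUMN WORD `w_c : 𝔽_q → 𝔽_q` (`kiWord`,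
`kiPer_eq_wordPoly`). For any two words `w_a, w_b` the NON-INJECTIVE seed rename (`mergeSub`)
`σ_{a←b} (k, y) := (k, w_a k)` if `y = w_b k`, else `(k, y)`, maps EVERY word polynomial to a word polynomial:
`rename σ (wordPoly w) = wordPoly (patch w_a w_b w)` with `(patch w_a w_b w) k := w_a k` if `w k = w_b k`, else
`w k` (`rename_mergeSub_wordPoly`), `patch w_a w_b w_b = w_a` — the block `b` is MERGED into `a`, `σ(P_b) = P_a`:
`σ` realises the substitution `z_b ↦ z_a` ("set the linear form `z_a − z_b` to `0`", the Dvir–Shpilka /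
Kayal–Saraf restriction step) on the IMAGE of `φ` — and `rename σ ∘ φ_W = φ_{patch W}` for every word family `W`
(`rename_mergeSub_bind₁`). The tree's zero-outs (`…ZeroedBlocks`) kill whole blocks and its symmetries
(`…Symmetry`) are injective renames; merging is neither.

## Goodness: the patch budget (§2)

`wordPoly w ≠ wordPoly w'` as soon as the words differ at ONE of the `m²` permanent positions
(`wordPoly_ne_of_apply_ne`). Two distinct curves agree on `≤ 2` positions (`card_agree_kiWord_le`, from
`quadDesign_isNWDesign`); a once-patched curve word differs from its quadratic on `≤ 2` positions, a twice-patched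
one on `≤ 8`; hence for `m ≥ 5` (`m² ≥ 25 > 2 + 8 + 8`) two distinct labels outside `{b, y}` keep distinct
twice-patched word polynomials (`wordPoly_word2_ne`). SHARPNESS: at `m = 2` one merge already identifies further
curves — the four-term second differences annihilating `G_2` (`…LowDegreeRung`) are exactly this failure.

## ★ The two-merge lemma (§3, `kiPer_twoMerge_eq_zero`, `m ≥ 5`)

For finite edge sets `E₁ ∋ (a,b)`, `E₂ ∋ (x,y)` with `{a,b} ∩ {x,y} = ∅` and a loopless `E₃` avoiding `{a,b}` and
`{x,y}` (as unordered pairs), with `Δ_E := ∏_{(u,v) ∈ E} (z_u − z_v)` (`dprod`):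
`φ(α₁Δ_{E₁} + α₂Δ_{E₂} + α₃Δ_{E₃}) = 0 ⟹ α₃ = 0`. Proof: merge `b → a`, then `y → x` on the once-patched words:
the `E₁`- and `E₂`-products acquire a zero factor, the `E₃`-product is a product of differences of DISTINCT
twice-patched block polynomials, nonzero in the domain `ℂ[y]`. No irreducibility, no unique factorisation, no
rank bound is used.

## Where this sits (HONEST BOUNDARY)

The sequel `DefinabilityGapThreeMatchings` turns the lemma into: for `m ≥ 6`, `G_m` hits every nonzero
`α₁Δ_{M₁} + α₂Δ_{M₂} + α₃Δ_{M₃}`, `M_j` arbitrary finite MATCHINGS of blocks — no width / degree / size hypothesis.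
Members with `|M_j| = n ≥ ⌈m/2⌉`, e.g. `M₁ = {(2i−1,2i)}`, `M₂ = {(2i,2i+1)} ∪ {(2n,1)}`,
`M₃ = {(4i−3,4i−1),(4i−2,4i)}` on `2n` blocks, are read-once of width `≤ 10`, of degree `n`, and lie in the
majority ideal `I_{⌈m/2⌉−1}` (every restriction to `≤ n − 1` free blocks vanishes at EVERY base point): the
residual of every restriction road of the lineage. Only GRAPHICAL forms `z_a − z_b` merge (fan-in `k` costs a patch
budget `≈ 3^{k−1}`); fan-in ≥ 4, general affine forms and the leaf regime w = q^b ≫ m are NOT claimed;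
K1 / stmt-23704 / VP ≠ VNP untouched.
-/

noncomputable section

open MvPolynomial
open Literature.Computability.AlgebraicComplexity Literature.Computability.MetaComplexity
open Summit.ValiantsHypothesis.ValiantsHypothesis.Theorems.DefinabilityGapAffineRung
open Summit.ValiantsHypothesis.ValiantsHypothesis.Theorems.DefinabilityGapSymmetry

set_option linter.dupNamespace false

namespace Summit.ValiantsHypothesis.ValiantsHypothesis.Theorems.DefinabilityGapBlockMerging

variable {m : ℕ}

/-! ## 1. Row-faithful column words and the merging substitution -/

/-- The column word of the curve `c`: position `k ↦` the ordinate of the `k`-th seed of `S_c`. [this file] -/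
def kiWord (m : ℕ) (c : Fin 3 → Fin (qOf m)) : Fin (qOf m) → Fin (qOf m) :=
  fun k => (quadDesign m c k).2

/-- Row-faithfulness: the `k`-th seed of curve `c` is `(k, w_c k)`. [this file] -/
theorem quadDesign_eq_kiWord (c : Fin 3 → Fin (qOf m)) (k : Fin (qOf m)) :
    quadDesign m c k = (k, kiWord m c k) := by
  exact Prod.ext (quadDesign_fst m c k) rfl

/-- The cell map of a word: permanent position `jk ↦ (p, w p)`, `p = permPad jk`. [this file] -/
def wordCell (m : ℕ) (w : Fin (qOf m) → Fin (qOf m)) (jk : Fin m × Fin m) : Fin (qOf m) × Fin (qOf m) :=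
  (permPad (sq_le_qOf m) jk, w (permPad (sq_le_qOf m) jk))

/-- Cell maps of words are injective (first coordinates are the positions). [this file] -/
theorem wordCell_injective (w : Fin (qOf m) → Fin (qOf m)) : Function.Injective (wordCell m w) := by
  intro jk jk' h; exact (permPad (sq_le_qOf m)).injective (Prod.ext_iff.1 h).1

/-- The permanent read along the word `w`: `per_m` renamed along the cell map of `w`. [this file] -/
def wordPoly (m : ℕ) (w : Fin (qOf m) → Fin (qOf m)) : MvPolynomial (Fin (qOf m) × Fin (qOf m)) ℂ :=
  rename (wordCell m w) (perPoly (Fin m) ℂ)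

/-- `P_c` is the permanent read along the column word of `c`. [this file] -/
theorem kiPer_eq_wordPoly (c : Fin 3 → Fin (qOf m)) : kiPer m c = wordPoly m (kiWord m c) := by
  have h : (⇑(cellEmb m c) : Fin m × Fin m → Fin (qOf m) × Fin (qOf m)) = wordCell m (kiWord m c) := by
    funext jk
    show quadDesign m c (permPad (sq_le_qOf m) jk) =
      (permPad (sq_le_qOf m) jk, kiWord m c (permPad (sq_le_qOf m) jk))
    exact quadDesign_eq_kiWord c _
  rw [kiPer_eq_rename_cellEmb, wordPoly, ← h]

/-- The merging substitution on seeds: `(k, w_b k) ↦ (k, w_a k)`, identity elsewhere. [this file] -/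
def mergeSub (m : ℕ) (wa wb : Fin (qOf m) → Fin (qOf m)) (s : Fin (qOf m) × Fin (qOf m)) :
    Fin (qOf m) × Fin (qOf m) :=
  if s.2 = wb s.1 then (s.1, wa s.1) else s

/-- The patched word: `w` with its agreements with `w_b` overwritten by `w_a`. [this file] -/
def patch (wa wb w : Fin (qOf m) → Fin (qOf m)) : Fin (qOf m) → Fin (qOf m) :=
  fun k => if w k = wb k then wa k else w k

/-- Merging `b` into `a` turns `w_b` into `w_a`. [this file] -/
theorem patch_apply_self (wa wb : Fin (qOf m) → Fin (qOf m)) : patch wa wb wb = wa := by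
  funext k
  show (if wb k = wb k then wa k else wb k) = wa k
  rw [if_pos rfl]

/-- Merging `b` into `a` leaves `w_a` unchanged. [this file] -/
theorem patch_apply_left (wa wb : Fin (qOf m) → Fin (qOf m)) : patch wa wb wa = wa := by
  funext k
  show (if wa k = wb k then wa k else wa k) = wa k
  split_ifs <;> rfl

/-- The merging substitution acts on cells as the patch acts on words. [this file] -/
theorem mergeSub_wordCell (wa wb w : Fin (qOf m) → Fin (qOf m)) (jk : Fin m × Fin m) :
    mergeSub m wa wb (wordCell m w jk) = wordCell m (patch wa wb w) jk := by
  by_cases h : w (permPad (sq_le_qOf m) jk) = wb (permPad (sq_le_qOf m) jk)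
  · have h1 : mergeSub m wa wb (wordCell m w jk) =
        (permPad (sq_le_qOf m) jk, wa (permPad (sq_le_qOf m) jk)) := if_pos h
    have h2 : patch wa wb w (permPad (sq_le_qOf m) jk) = wa (permPad (sq_le_qOf m) jk) := if_pos h
    rw [h1, wordCell, h2]
  · have h1 : mergeSub m wa wb (wordCell m w jk) = wordCell m w jk := if_neg h
    have h2 : patch wa wb w (permPad (sq_le_qOf m) jk) = w (permPad (sq_le_qOf m) jk) := if_neg h
    rw [h1, wordCell, wordCell, h2]

/-- **Merging keeps word polynomials word polynomials.** [this file] -/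
theorem rename_mergeSub_wordPoly (wa wb w : Fin (qOf m) → Fin (qOf m)) :
    rename (mergeSub m wa wb) (wordPoly m w) = wordPoly m (patch wa wb w) := by
  rw [wordPoly, wordPoly, rename_rename]
  exact congrArg (fun f : Fin m × Fin m → Fin (qOf m) × Fin (qOf m) => rename f (perPoly (Fin m) ℂ))
    (funext fun jk => mergeSub_wordCell wa wb w jk)

/-- **Merging commutes with substitution**: `rename σ ∘ φ_W = φ_{patch W}`. [this file] -/
theorem rename_mergeSub_bind₁ {ι : Type*} (W : ι → Fin (qOf m) → Fin (qOf m))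
    (wa wb : Fin (qOf m) → Fin (qOf m)) (D : MvPolynomial ι ℂ) :
    rename (mergeSub m wa wb) (bind₁ (fun c => wordPoly m (W c)) D) =
      bind₁ (fun c => wordPoly m (patch wa wb (W c))) D := by
  rw [rename_bind₁]
  exact congrArg (fun f : ι → MvPolynomial (Fin (qOf m) × Fin (qOf m)) ℂ => bind₁ f D)
    (funext fun c => rename_mergeSub_wordPoly wa wb (W c))

/-- The once-patched curve words (block `b` merged into block `a`). [this file] -/
def word1 (m : ℕ) (a b c : Fin 3 → Fin (qOf m)) : Fin (qOf m) → Fin (qOf m) :=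
  patch (kiWord m a) (kiWord m b) (kiWord m c)

/-- The twice-patched curve words (`b` into `a`, then `y` into `x` on the once-patched words). [this file] -/
def word2 (m : ℕ) (a b x y c : Fin 3 → Fin (qOf m)) : Fin (qOf m) → Fin (qOf m) :=
  patch (word1 m a b x) (word1 m a b y) (word1 m a b c)

/-- After the first merge `b` carries the word of `a`. [this file] -/
theorem word1_self (a b : Fin 3 → Fin (qOf m)) : word1 m a b b = kiWord m a := by
  exact patch_apply_self (kiWord m a) (kiWord m b)

/-- The first merge does not move `a`. [this file] -/
theorem word1_left (a b : Fin 3 → Fin (qOf m)) : word1 m a b a = kiWord m a := by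
  exact patch_apply_left (kiWord m a) (kiWord m b)

/-- After the second merge `y` carries the once-patched word of `x`. [this file] -/
theorem word2_self (a b x y : Fin 3 → Fin (qOf m)) : word2 m a b x y y = word1 m a b x := by
  exact patch_apply_self (word1 m a b x) (word1 m a b y)

/-- The second merge does not move `x`. [this file] -/
theorem word2_left (a b x y : Fin 3 → Fin (qOf m)) : word2 m a b x y x = word1 m a b x := by
  exact patch_apply_left (word1 m a b x) (word1 m a b y)

/-- After both merges `b` and `a` carry the same word. [this file] -/
theorem word2_b (a b x y : Fin 3 → Fin (qOf m)) : word2 m a b x y b = word2 m a b x y a := by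
  unfold word2
  rw [word1_self, word1_left]

/-- After both merges `y` and `x` carry the same word. [this file] -/
theorem word2_y (a b x y : Fin 3 → Fin (qOf m)) : word2 m a b x y y = word2 m a b x y x := by
  rw [word2_self, word2_left]

/-- The first merge applied to `φ`: `rename σ_{a←b} (φ D) = φ_{W′} D`. [this file] -/
theorem rename_merge₁_bind₁ (a b : Fin 3 → Fin (qOf m)) (D : MvPolynomial (Fin 3 → Fin (qOf m)) ℂ) :
    rename (mergeSub m (kiWord m a) (kiWord m b)) (bind₁ (kiPer m) D) =
      bind₁ (fun c => wordPoly m (word1 m a b c)) D := by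
  have hk : kiPer m = fun c => wordPoly m (kiWord m c) := funext fun c => kiPer_eq_wordPoly c
  rw [hk]
  exact rename_mergeSub_bind₁ (kiWord m) (kiWord m a) (kiWord m b) D

/-- The second merge applied to the once-merged `φ`: `rename σ_{x←y} (φ_{W′} D) = φ_{W″} D`. [this file] -/
theorem rename_merge₂_bind₁ (a b x y : Fin 3 → Fin (qOf m)) (D : MvPolynomial (Fin 3 → Fin (qOf m)) ℂ) :
    rename (mergeSub m (word1 m a b x) (word1 m a b y)) (bind₁ (fun c => wordPoly m (word1 m a b c)) D) =
      bind₁ (fun c => wordPoly m (word2 m a b x y c)) D := by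
  exact rename_mergeSub_bind₁ (word1 m a b) (word1 m a b x) (word1 m a b y) D

/-! ## 2. Goodness: the patch budget -/

/-- Word polynomials of words differing at one permanent position differ. [this file] -/
theorem wordPoly_ne_of_apply_ne {w w' : Fin (qOf m) → Fin (qOf m)} (jk : Fin m × Fin m)
    (h : w (permPad (sq_le_qOf m) jk) ≠ w' (permPad (sq_le_qOf m) jk)) : wordPoly m w ≠ wordPoly m w' := by
  intro heq
  have h1 : wordCell m w jk ∈ (wordPoly m w).vars := by
    rw [mem_vars_iff_degreeOf_ne_zero, wordPoly, degreeOf_rename_of_injective (wordCell_injective w),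
      degreeOf_perPoly ℂ]
    exact one_ne_zero
  rw [heq, wordPoly] at h1
  obtain ⟨jk', -, hjk'⟩ := Finset.mem_image.1 (vars_rename _ _ h1)
  have hjj : jk' = jk := (permPad (sq_le_qOf m)).injective (Prod.ext_iff.1 hjk').1
  subst hjj
  exact h (Prod.ext_iff.1 hjk').2.symm

/-- The agreement set of two words. [this file] -/
def agree (w w' : Fin (qOf m) → Fin (qOf m)) : Finset (Fin (qOf m)) :=
  Finset.univ.filter fun k => w k = w' k

/-- The difference set of two words. [this file] -/
def differ (w w' : Fin (qOf m) → Fin (qOf m)) : Finset (Fin (qOf m)) :=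
  Finset.univ.filter fun k => w k ≠ w' k

/-- Membership in the agreement set. [this file] -/
theorem mem_agree {w w' : Fin (qOf m) → Fin (qOf m)} {k : Fin (qOf m)} : k ∈ agree w w' ↔ w k = w' k := by
  simp [agree]

/-- Membership in the difference set. [this file] -/
theorem mem_differ {w w' : Fin (qOf m) → Fin (qOf m)} {k : Fin (qOf m)} : k ∈ differ w w' ↔ w k ≠ w' k := by
  simp [differ]

/-- Two distinct curves agree on at most `2` positions (pairwise intersections `≤ 2`). [this file] -/
theorem card_agree_kiWord_le {c c' : Fin 3 → Fin (qOf m)} (hcc' : c ≠ c') :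
    (agree (kiWord m c) (kiWord m c')).card ≤ 2 := by
  have hsub : (agree (kiWord m c) (kiWord m c')).map (quadDesign m c) ⊆
      Finset.univ.map (quadDesign m c) ∩ Finset.univ.map (quadDesign m c') := by
    intro s hs
    obtain ⟨k, hk, rfl⟩ := Finset.mem_map.1 hs
    refine Finset.mem_inter.2 ⟨Finset.mem_map_of_mem _ (Finset.mem_univ _),
      Finset.mem_map.2 ⟨k, Finset.mem_univ _, ?_⟩⟩
    rw [quadDesign_eq_kiWord, quadDesign_eq_kiWord, mem_agree.1 hk]
  calc (agree (kiWord m c) (kiWord m c')).card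
      = ((agree (kiWord m c) (kiWord m c')).map (quadDesign m c)).card := (Finset.card_map _).symm
    _ ≤ (Finset.univ.map (quadDesign m c) ∩ Finset.univ.map (quadDesign m c')).card :=
        Finset.card_le_card hsub
    _ ≤ 2 := quadDesign_isNWDesign m hcc'

/-- A patched word differs from the original only where the original agrees with `w_b`. [this file] -/
theorem differ_patch_subset (wa wb w : Fin (qOf m) → Fin (qOf m)) : differ (patch wa wb w) w ⊆ agree w wb := by
  intro k hk
  rw [mem_differ] at hk; rw [mem_agree]
  by_contra h; exact hk (if_neg h)

/-- Triangle inequality for difference sets. [this file] -/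
theorem differ_triangle (u v w : Fin (qOf m) → Fin (qOf m)) : differ u w ⊆ differ u v ∪ differ v w := by
  intro k hk
  rw [Finset.mem_union, mem_differ, mem_differ]; rw [mem_differ] at hk
  by_cases h1 : u k = v k
  · exact Or.inr fun h2 => hk (h1.trans h2)
  · exact Or.inl h1

/-- Agreements of perturbed words come from agreements of the originals or from perturbed positions.
[this file] -/
theorem agree_subset (u u₀ v v₀ : Fin (qOf m) → Fin (qOf m)) :
    agree u v ⊆ agree u₀ v₀ ∪ differ u u₀ ∪ differ v v₀ := by
  intro k hk
  rw [Finset.mem_union, Finset.mem_union, mem_agree, mem_differ, mem_differ]; rw [mem_agree] at hk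
  by_cases h1 : u k = u₀ k
  · by_cases h2 : v k = v₀ k
    · exact Or.inl (Or.inl (h1.symm.trans (hk.trans h2)))
    · exact Or.inr h2
  · exact Or.inl (Or.inr h1)

/-- Patch budget after one merge: `≤ 2` positions. [this file] -/
theorem card_differ_word1_le {a b c : Fin 3 → Fin (qOf m)} (hcb : c ≠ b) :
    (differ (word1 m a b c) (kiWord m c)).card ≤ 2 := by
  exact (Finset.card_le_card (differ_patch_subset (kiWord m a) (kiWord m b) (kiWord m c))).trans
    (card_agree_kiWord_le hcb)

/-- Patch budget after two merges: `≤ 8` positions. [this file] -/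
theorem card_differ_word2_le {a b x y c : Fin 3 → Fin (qOf m)} (hcb : c ≠ b) (hcy : c ≠ y) (hyb : y ≠ b) :
    (differ (word2 m a b x y c) (kiWord m c)).card ≤ 8 := by
  have h1 := Finset.card_le_card (differ_triangle (word2 m a b x y c) (word1 m a b c) (kiWord m c))
  have h2 : (differ (word2 m a b x y c) (word1 m a b c)).card ≤
      (agree (word1 m a b c) (word1 m a b y)).card :=
    Finset.card_le_card (differ_patch_subset (word1 m a b x) (word1 m a b y) (word1 m a b c))
  have h3 := Finset.card_le_card (agree_subset (word1 m a b c) (kiWord m c) (word1 m a b y) (kiWord m y))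
  have h4 := (agree (kiWord m c) (kiWord m y) ∪ differ (word1 m a b c) (kiWord m c)).card_union_le
    (differ (word1 m a b y) (kiWord m y))
  have h5 := Finset.card_union_le (agree (kiWord m c) (kiWord m y)) (differ (word1 m a b c) (kiWord m c))
  have h6 := (differ (word2 m a b x y c) (word1 m a b c)).card_union_le (differ (word1 m a b c) (kiWord m c))
  have h7 := card_agree_kiWord_le (m := m) hcy
  have h8 := card_differ_word1_le (m := m) (a := a) hcb
  have h9 := card_differ_word1_le (m := m) (a := a) hyb
  omega

/-- **Goodness after two merges** (`m ≥ 5`): distinct labels outside `{b, y}` keep distinct word polynomials.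
[this file] -/
theorem wordPoly_word2_ne (hm : 5 ≤ m) {a b x y u v : Fin 3 → Fin (qOf m)} (huv : u ≠ v) (hub : u ≠ b)
    (huy : u ≠ y) (hvb : v ≠ b) (hvy : v ≠ y) (hyb : y ≠ b) :
    wordPoly m (word2 m a b x y u) ≠ wordPoly m (word2 m a b x y v) := by
  have h1 :=
    Finset.card_le_card (agree_subset (word2 m a b x y u) (kiWord m u) (word2 m a b x y v) (kiWord m v))
  have h2 := Finset.card_union_le (agree (kiWord m u) (kiWord m v) ∪ differ (word2 m a b x y u) (kiWord m u))
    (differ (word2 m a b x y v) (kiWord m v))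
  have h3 := Finset.card_union_le (agree (kiWord m u) (kiWord m v)) (differ (word2 m a b x y u) (kiWord m u))
  have h4 := card_agree_kiWord_le (m := m) huv
  have h5 := card_differ_word2_le (m := m) (a := a) (x := x) hub huy hyb
  have h6 := card_differ_word2_le (m := m) (a := a) (x := x) hvb hvy hyb
  have hmm := Nat.mul_le_mul hm hm
  have hcard : (Finset.univ.map (permPad (sq_le_qOf m))).card = m * m := by
    rw [Finset.card_map, Finset.card_univ, Fintype.card_prod, Fintype.card_fin]
  have hlt : (agree (word2 m a b x y u) (word2 m a b x y v)).card <
      (Finset.univ.map (permPad (sq_le_qOf m))).card := by rw [hcard]; omega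
  obtain ⟨p, hp, hpa⟩ := Finset.exists_mem_notMem_of_card_lt_card hlt
  obtain ⟨jk, -, rfl⟩ := Finset.mem_map.1 hp
  exact wordPoly_ne_of_apply_ne jk fun he => hpa (mem_agree.2 he)

/-! ## 3. The two-merge lemma -/

/-- The product of differences over a finite edge set: `Δ_E = ∏_{(u,v) ∈ E} (z_u − z_v)`. [this file] -/
def dprod (E : Finset ((Fin 3 → Fin (qOf m)) × (Fin 3 → Fin (qOf m)))) :
    MvPolynomial (Fin 3 → Fin (qOf m)) ℂ :=
  ∏ e ∈ E, (X e.1 - X e.2)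

/-- Substituting into a product of differences. [this file] -/
theorem bind₁_dprod {τ : Type*} (P : (Fin 3 → Fin (qOf m)) → MvPolynomial τ ℂ)
    (E : Finset ((Fin 3 → Fin (qOf m)) × (Fin 3 → Fin (qOf m)))) :
    bind₁ P (dprod E) = ∏ e ∈ E, (P e.1 - P e.2) := by
  rw [dprod, map_prod]
  refine Finset.prod_congr rfl fun e _ => ?_
  rw [map_sub, bind₁_X_right, bind₁_X_right]

/-- A factor of the surviving product is nonzero: the endpoints have distinct twice-patched words. [this file] -/
theorem wordPoly_word2_sub_ne_zero (hm : 5 ≤ m) {a b x y : Fin 3 → Fin (qOf m)} (hab : a ≠ b) (hxa : x ≠ a)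
    (hxb : x ≠ b) (hya : y ≠ a) (hxy : x ≠ y) (hyb : y ≠ b) {u v : Fin 3 → Fin (qOf m)} (huv : u ≠ v)
    (h₁ : (u, v) ≠ (a, b)) (h₂ : (u, v) ≠ (b, a)) (h₃ : (u, v) ≠ (x, y)) (h₄ : (u, v) ≠ (y, x)) :
    wordPoly m (word2 m a b x y u) - wordPoly m (word2 m a b x y v) ≠ 0 := by
  rw [sub_ne_zero]
  have hne : ∀ {p q : Fin 3 → Fin (qOf m)}, (u, v) ≠ (p, q) → u = p → v ≠ q :=
    fun h hp hq => h (Prod.ext hp hq)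
  by_cases hub : u = b
  · rw [hub, word2_b]
    by_cases hvy : v = y
    · rw [hvy, word2_y]
      exact wordPoly_word2_ne hm hxa.symm hab hya.symm hxb hxy hyb
    · have hva : v ≠ a := hne h₂ hub
      have hvb : v ≠ b := fun h => huv (hub.trans h.symm)
      exact wordPoly_word2_ne hm hva.symm hab hya.symm hvb hvy hyb
  · by_cases huy : u = y
    · rw [huy, word2_y]
      by_cases hvb : v = b
      · rw [hvb, word2_b]
        exact wordPoly_word2_ne hm hxa hxb hxy hab hya.symm hyb
      · have hvx : v ≠ x := hne h₄ huy
        have hvy : v ≠ y := fun h => huv (huy.trans h.symm)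
        exact wordPoly_word2_ne hm hvx.symm hxb hxy hvb hvy hyb
    · by_cases hvb : v = b
      · rw [hvb, word2_b]
        have hua : u ≠ a := fun h => h₁ (Prod.ext h hvb)
        exact wordPoly_word2_ne hm hua hub huy hab hya.symm hyb
      · by_cases hvy : v = y
        · rw [hvy, word2_y]
          have hux : u ≠ x := fun h => h₃ (Prod.ext h hvy)
          exact wordPoly_word2_ne hm hux hub huy hxb hxy hyb
        · exact wordPoly_word2_ne hm huv hub huy hvb hvy hyb

/-- ★ **THE TWO-MERGE LEMMA** (`m ≥ 5`): if `E₁ ∋ (a,b)` and `E₂ ∋ (x,y)` with `{a,b} ∩ {x,y} = ∅`, and the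
loopless edge set `E₃` avoids `{a,b}` and `{x,y}`, then `φ(α₁Δ_{E₁} + α₂Δ_{E₂} + α₃Δ_{E₃}) = 0` forces `α₃ = 0`:
merging `b → a` and then `y → x` kills the first two products and keeps the third nonzero. [this file] -/
theorem kiPer_twoMerge_eq_zero (hm : 5 ≤ m) {a b x y : Fin 3 → Fin (qOf m)} (hab : a ≠ b) (hxa : x ≠ a)
    (hxb : x ≠ b) (hya : y ≠ a) (hyb : y ≠ b) (hxy : x ≠ y)
    {E₁ E₂ E₃ : Finset ((Fin 3 → Fin (qOf m)) × (Fin 3 → Fin (qOf m)))}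
    (h₁ : (a, b) ∈ E₁) (h₂ : (x, y) ∈ E₂)
    (h₃ : ∀ e ∈ E₃, e.1 ≠ e.2 ∧ e ≠ (a, b) ∧ e ≠ (b, a) ∧ e ≠ (x, y) ∧ e ≠ (y, x))
    {α₁ α₂ α₃ : ℂ} (h0 : bind₁ (kiPer m) (C α₁ * dprod E₁ + C α₂ * dprod E₂ + C α₃ * dprod E₃) = 0) :
    α₃ = 0 := by
  have hφ := congrArg (rename (mergeSub m (word1 m a b x) (word1 m a b y)))
    (congrArg (rename (mergeSub m (kiWord m a) (kiWord m b))) h0)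
  rw [map_zero, map_zero, rename_merge₁_bind₁, rename_merge₂_bind₁] at hφ
  simp only [map_add, map_mul, bind₁_C_right, bind₁_dprod] at hφ
  have hz₁ : ∏ e ∈ E₁, (wordPoly m (word2 m a b x y e.1) - wordPoly m (word2 m a b x y e.2)) = 0 :=
    Finset.prod_eq_zero h₁ (by
      show wordPoly m (word2 m a b x y a) - wordPoly m (word2 m a b x y b) = 0
      rw [word2_b]; exact sub_self _)
  have hz₂ : ∏ e ∈ E₂, (wordPoly m (word2 m a b x y e.1) - wordPoly m (word2 m a b x y e.2)) = 0 :=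
    Finset.prod_eq_zero h₂ (by
      show wordPoly m (word2 m a b x y x) - wordPoly m (word2 m a b x y y) = 0
      rw [word2_y]; exact sub_self _)
  have hne₃ : ∏ e ∈ E₃, (wordPoly m (word2 m a b x y e.1) - wordPoly m (word2 m a b x y e.2)) ≠ 0 := by
    rw [Finset.prod_ne_zero_iff]
    intro e he
    obtain ⟨hl, hab', hba', hxy', hyx'⟩ := h₃ e he
    exact wordPoly_word2_sub_ne_zero hm hab hxa hxb hya hxy hyb hl hab' hba' hxy' hyx'
  rw [hz₁, hz₂, mul_zero, mul_zero, zero_add, zero_add] at hφ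
  exact (mul_eq_zero.1 hφ).elim (fun h => C_eq_zero.1 h) fun h => absurd h hne₃

end Summit.ValiantsHypothesis.ValiantsHypothesis.Theorems.DefinabilityGapBlockMerging
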